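import Mathlib
import Literature.NumberTheory.Transcendental.KZProduct
import Literature.NumberTheory.Transcendental.KZVolumeConjectureProofs
import Literature.NumberTheory.Transcendental.KZKernelConjectureForms
import Summits.KontsevichZagierPeriods.KontsevichZagierPeriods.Theorems.SoloInformedLocSplit
import Summits.KontsevichZagierPeriods.KontsevichZagierPeriods.Theorems.SoloInformedVolumeLadder
import Summits.KontsevichZagierPeriods.KontsevichZagierPeriods.Theorems.SoloInformedRungOne
import Summits.KontsevichZagierPeriods.KontsevichZagierPeriods.Theorems.SoloInformedRungTwoFinal
import HarnessLib
import HarnessLib.Audit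

/-!
# SoloInformed — `KZ.PiCancellation` is disc cancellation on the volume ladder

`Theorems/SoloInformedLocSplit.lean` splits the summit, with no hypotheses, as
`KZP ⟺ KZLocAt ⟦[π]⟧ ∧ KZ.PiCancellation`; `Theorems/SoloInformedThetaPi.lean` shows that the
cancellation conjunct is the same at Ayoub's localising element `θ₀ = 2·⟦[π]⟧`.  This file gives the
cancellation conjunct a purely GEOMETRIC form, graded by dimension like the volume ladder of
`Theorems/SoloInformedVolumeLadder.lean`:

* `SoloInformedDiscCancellationRung d` — *disc cancellation at rung `d`*: if the solid cylinders
  `D̄ × K`, `D̄ × K' ⊂ ℝ^{2+d}` over two compact `ℚ`-semialgebraic sets `K, K' ⊂ ℝᵈ` with non-empty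
  interior are connected by the four KZ moves, then so are `K` and `K'`;
* `soloInformed_piCancellation_iff_forall_discCancellationRung` — **`KZ.PiCancellation ⟺ ∀ d,
  disc cancellation at rung d`** (every formal combination is, modulo moves, a difference of two
  volume representations of one dimension: Viu-Sos' semi-canonical reduction, in the tree);
* `soloInformed_discCancellationRung_mono` — the rungs are nested (`d + 1 ⇒ d`, unit slabs), hence
  `soloInformed_piCancellation_iff_discCancellation_ge : PiCancellation ⟺ ∀ d ≥ d₀, rung d` for
  every `d₀`;
* `soloInformed_discCancellationRung_of_volumeRung` — volume rung `d` ⇒ disc cancellation at rung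
  `d` (compare VALUES: `vol(D̄ × K) = π · vol K`), so disc cancellation holds unconditionally for
  `d ≤ 1` and, granted the Huber–Wüstholz theorem on curve periods, for `d ≤ 2`
  (`soloInformed_discCancellationRung_le_two`);
* `soloInformed_kzp_iff_locPi_and_discCancellation` — the summit is
  `KZLocAt ⟦[π]⟧ ∧ ∀ d ≥ 3, disc cancellation at rung d`, with no hypotheses.

The point of the grading.  Volume rung `d` ("equal volume ⇒ connected by moves") has transcendence
content from `d = 3` on (it contains `π² ∉ ℚ·log 2·log 3`, an open case of the weak four-exponentials
conjecture; residency paper Thm. II); disc cancellation at rung `d` has NONE: its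
hypothesis is a chain of moves, not a numerical coincidence.  It isolates the combinatorial half of
the conjecture — "a disc factor can be cancelled in the scissors-type calculus of the four moves" —
whose motivic name (paper, Prop. V) is the fullness of effective Nori motives inside all Nori
motives.  The smallest open instance is rung `3`: solids `K, K' ⊂ ℝ³`, cylinders in `ℝ⁵`.

References: M. Kontsevich, D. Zagier, *Periods* (2001), §1.2, §4.1; J. Viu-Sos, IJNT 17 (2021),
Thm. 1.1; J. Cresson, J. Viu-Sos, JTNB 34 (2022), §1; A. Huber, G. Wüstholz, *Transcendence and
linear relations of 1-periods* (CUP 2022), Thm. 13.3, App. A.3.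
-/

noncomputable section

open Set MeasureTheory

open Literature.NumberTheory.Transcendental KZ

namespace Summit.KontsevichZagierPeriods.KontsevichZagierPeriods.Theorems

/-- A *volume representation*: compact domain with non-empty interior and integrand `1` on it
(the objects of the volume ladder). -/
def SoloInformedIsVolumeRep {d : ℕ} (K : IntegralRep d) : Prop :=
  IsCompact K.domain ∧ (interior K.domain).Nonempty ∧ ∀ x ∈ K.domain, K.integrand x = 1

/-- **Disc cancellation at rung `d`.** For volume representations `K, K'` of dimension `d`: if the
cylinders `[π]·[K] = [D̄ × K, 1]` and `[D̄ × K', 1]` are KZ-equivalent, then so are `K` and `K'`. -/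
def SoloInformedDiscCancellationRung (d : ℕ) : Prop :=
  ∀ K K' : IntegralRep d, SoloInformedIsVolumeRep K → SoloInformedIsVolumeRep K' →
    Equivalent (piRep.prod K) (piRep.prod K') → Equivalent K K'

/-! ### Values: volume rung `d` implies disc cancellation at rung `d` -/

/-- Volume rung `d` ⇒ disc cancellation at rung `d`: equivalent cylinders have equal volumes
`π · vol K = π · vol K'`, so `vol K = vol K'` and the volume rung applies. -/
theorem soloInformed_discCancellationRung_of_volumeRung {d : ℕ} (h : SoloInformedVolumeRung d) :
    SoloInformedDiscCancellationRung d := by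
  intro K K' hK hK' hE
  have hv : (piRep.prod K).value = (piRep.prod K').value := Equivalent.value_eq_holds hE
  rw [IntegralRep.value_piRep_prod, IntegralRep.value_piRep_prod] at hv
  exact h K K' hK.1 hK.2.1 hK'.1 hK'.2.1 hK.2.2 hK'.2.2 (mul_left_cancel₀ Real.pi_ne_zero hv)

/-- Disc cancellation holds unconditionally at rungs `d ≤ 1`. -/
theorem soloInformed_discCancellationRung_le_one {d : ℕ} (hd : d ≤ 1) :
    SoloInformedDiscCancellationRung d :=
  soloInformed_discCancellationRung_of_volumeRung (soloInformed_volumeRung_le_one hd)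

/-- Disc cancellation holds at rungs `d ≤ 2`, granted the Huber–Wüstholz theorem on the linear
relations of curve periods (through volume rung `2`, `soloInformed_volumeRung_le_two`). -/
theorem soloInformed_discCancellationRung_le_two (hHW : HuberWustholzCurvePeriods) {d : ℕ}
    (hd : d ≤ 2) : SoloInformedDiscCancellationRung d :=
  soloInformed_discCancellationRung_of_volumeRung (soloInformed_volumeRung_le_two hHW hd)

/-! ### `KZ.PiCancellation` implies every disc cancellation rung -/

/-- In `FormalRep`: `[π] * ([K] − [K']) = [D̄ × K] − [D̄ × K']`. -/
theorem soloInformed_of_piRep_mul_sub {d : ℕ} (K K' : IntegralRep d) :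
    of piRep * (of K - of K') = of (piRep.prod K) - of (piRep.prod K') := by
  rw [mul_sub, of_mul_of, of_mul_of]

/-- `KZ.PiCancellation` ⇒ disc cancellation at every rung. -/
theorem soloInformed_discCancellationRung_of_piCancellation (h : PiCancellation) (d : ℕ) :
    SoloInformedDiscCancellationRung d := by
  intro K K' _ _ hE
  refine h (of K - of K') ?_
  rw [soloInformed_of_piRep_mul_sub]
  exact hE

/-! ### Normal form: every formal combination is a difference of two volume representations -/

/-- **Volume normal form of formal combinations.** Every `c : FormalRep` differs by relations from
`[M] − [M']` for two volume representations `M, M'` of one common dimension (any combination is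
`[r] − [r']` modulo relations, `KZ.exists_integralRep_sub`; each of `r, r'` is a difference of two
volume representations by Viu-Sos' semi-canonical reduction; raise to a common dimension by unit
slabs and glue the four pieces two by two, `exists_volumeRep_of_add_sub_of_mem_relations`). -/
theorem soloInformed_exists_volumeRep_sub (c : FormalRep) :
    ∃ (N : ℕ) (M M' : IntegralRep N), SoloInformedIsVolumeRep M ∧ SoloInformedIsVolumeRep M' ∧
      c - (of M - of M') ∈ relations := by
  obtain ⟨n, m, r, r', hc⟩ := exists_integralRep_sub_holds c
  obtain ⟨D, A, B, ⟨hAc, hAi, hA1⟩, ⟨hBc, hBi, hB1⟩, hr⟩ :=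
    IntegralRep.exists_sub_volumeRep_mem_relations_of_semiCanonicalReduction
      semiCanonicalReduction_holds r
  obtain ⟨D', A', B', ⟨hA'c, hA'i, hA'1⟩, ⟨hB'c, hB'i, hB'1⟩, hr'⟩ :=
    IntegralRep.exists_sub_volumeRep_mem_relations_of_semiCanonicalReduction
      semiCanonicalReduction_holds r'
  -- raise everything to dimension `D + D'`
  obtain ⟨A₁, hA₁c, hA₁i, hA₁1, eA⟩ :=
    A.exists_volumeRep_equivalent_of_le hAc hAi hA1 (Nat.le_add_right D D')
  obtain ⟨B₁, hB₁c, hB₁i, hB₁1, eB⟩ :=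
    B.exists_volumeRep_equivalent_of_le hBc hBi hB1 (Nat.le_add_right D D')
  obtain ⟨A₁', hA₁'c, hA₁'i, hA₁'1, eA'⟩ :=
    A'.exists_volumeRep_equivalent_of_le hA'c hA'i hA'1 (Nat.le_add_left D' D)
  obtain ⟨B₁', hB₁'c, hB₁'i, hB₁'1, eB'⟩ :=
    B'.exists_volumeRep_equivalent_of_le hB'c hB'i hB'1 (Nat.le_add_left D' D)
  -- glue `A₁ ⊔ B₁'` and `B₁ ⊔ A₁'`
  obtain ⟨M, hMc, hMi, hM1, eM⟩ :=
    A₁.exists_volumeRep_of_add_sub_of_mem_relations B₁' hA₁c hA₁i hA₁1 hB₁'c hB₁'1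
  obtain ⟨M', hM'c, hM'i, hM'1, eM'⟩ :=
    B₁.exists_volumeRep_of_add_sub_of_mem_relations A₁' hB₁c hB₁i hB₁1 hA₁'c hA₁'1
  refine ⟨D + D' + 1, M, M', ⟨hMc, hMi, hM1⟩, ⟨hM'c, hM'i, hM'1⟩, ?_⟩
  have : c - (of M - of M') = (c - (of r - of r')) + (of r - (of A - of B))
      - (of r' - (of A' - of B')) + (of A - of A₁) - (of B - of B₁) - (of A' - of A₁')
      + (of B' - of B₁') + (of A₁ + of B₁' - of M) - (of B₁ + of A₁' - of M') := by
    abel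
  rw [this]
  exact relations.sub_mem (relations.add_mem (relations.add_mem (relations.sub_mem
    (relations.sub_mem (relations.add_mem (relations.sub_mem (relations.add_mem hc hr) hr') eA)
    eB) eA') eB') eM) eM'

/-! ### The equivalence -/

/-- **THEOREM: `KZ.PiCancellation ⟺` disc cancellation at every rung.** (`⇐`: write `c ≡ [M] − [M']`
in volume normal form; `[π]·c ≡ 0` gives `[D̄ × M] ∼ [D̄ × M']` in the formal period ring, disc
cancellation gives `M ∼ M'`, hence `c ≡ 0`.) -/
theorem soloInformed_piCancellation_iff_forall_discCancellationRung :
    PiCancellation ↔ ∀ d, SoloInformedDiscCancellationRung d := by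
  refine ⟨soloInformed_discCancellationRung_of_piCancellation, fun h c hc => ?_⟩
  obtain ⟨N, M, M', hM, hM', e⟩ := soloInformed_exists_volumeRep_sub c
  have h1 : toFormalPeriod (of M - of M') = toFormalPeriod c := by
    have := toFormalPeriod_eq_zero_iff.2 e
    rw [map_sub, sub_eq_zero] at this
    exact this.symm
  have hE : Equivalent (piRep.prod M) (piRep.prod M') := by
    rw [Equivalent, ← toFormalPeriod_eq_zero_iff, ← soloInformed_of_piRep_mul_sub, map_mul, h1,
      ← map_mul, toFormalPeriod_eq_zero_iff]
    exact hc
  have hMM' : of M - of M' ∈ relations := h N M M' hM hM' hE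
  have : c = (c - (of M - of M')) + (of M - of M') := by abel
  rw [this]
  exact relations.add_mem e hMM'

/-! ### The disc-cancellation rungs are nested -/

/-- The unit slab `K × [0, 1]` over a volume representation is a volume representation. -/
theorem soloInformed_isVolumeRep_slab {d : ℕ} {K : IntegralRep d} (hK : SoloInformedIsVolumeRep K) :
    SoloInformedIsVolumeRep (K.slab 0) :=
  ⟨K.isCompact_slabDomain 0 hK.1, K.interior_slabDomain_nonempty 0 hK.2.1,
    K.slab_integrand_eq_one 0 hK.2.2⟩

/-- In the formal period ring, `⟦[D̄ × K]⟧ = ⟦[D̄ × (K × [0,1])]⟧` (both are `⟦[π]⟧ · ⟦[K]⟧`). -/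
theorem soloInformed_toFormalPeriod_piRep_prod_slab {d : ℕ} (K : IntegralRep d) :
    toFormalPeriod (of (piRep.prod K)) = toFormalPeriod (of (piRep.prod (K.slab 0))) := by
  rw [← toFormalPeriod_of_mul_of, ← toFormalPeriod_of_mul_of,
    Equivalent.toFormalPeriod_eq (K.equivalent_slab 0)]

/-- **Monotonicity**: disc cancellation at rung `d + 1` implies it at rung `d` (stabilise `K`, `K'`
by the unit slab; one Newton–Leibniz move each). -/
theorem soloInformed_discCancellationRung_mono {d : ℕ} (h : SoloInformedDiscCancellationRung (d + 1)) :
    SoloInformedDiscCancellationRung d := by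
  intro K K' hK hK' hE
  have hE' : Equivalent (piRep.prod (K.slab 0)) (piRep.prod (K'.slab 0)) := by
    rw [Equivalent, ← toFormalPeriod_eq_iff, ← soloInformed_toFormalPeriod_piRep_prod_slab,
      ← soloInformed_toFormalPeriod_piRep_prod_slab, toFormalPeriod_eq_iff]
    exact hE
  have h1 : Equivalent (K.slab 0) (K'.slab 0) :=
    h _ _ (soloInformed_isVolumeRep_slab hK) (soloInformed_isVolumeRep_slab hK') hE'
  exact ((K.equivalent_slab 0).trans h1).trans (K'.equivalent_slab 0).symm

/-- Disc cancellation at rung `d'` implies it at every rung `d ≤ d'`. -/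
theorem soloInformed_discCancellationRung_of_le {d d' : ℕ} (hle : d ≤ d')
    (h : SoloInformedDiscCancellationRung d') : SoloInformedDiscCancellationRung d := by
  induction hle with
  | refl => exact h
  | step _ ih => exact ih (soloInformed_discCancellationRung_mono h)

/-- `KZ.PiCancellation ⟺` disc cancellation at all rungs `d ≥ d₀` (any `d₀`; by monotonicity). -/
theorem soloInformed_piCancellation_iff_discCancellation_ge (d₀ : ℕ) :
    PiCancellation ↔ ∀ d, d₀ ≤ d → SoloInformedDiscCancellationRung d := by
  rw [soloInformed_piCancellation_iff_forall_discCancellationRung]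
  refine ⟨fun h d _ => h d, fun h d => ?_⟩
  exact soloInformed_discCancellationRung_of_le (Nat.le_max_right d₀ d) (h _ (Nat.le_max_left d₀ d))

/-! ### The summit -/

/-- **THEOREM (no hypotheses): the summit is the localised conjecture at `⟦[π]⟧` together with disc
cancellation from rung `3` on** — rungs `≤ 2` being the regime where the needed transcendence is in
print (and rungs `≤ 1` unconditional), the residual geometric statement starts with solids in `ℝ³`. -/
theorem soloInformed_kzp_iff_locPi_and_discCancellation :
    KontsevichZagierPeriods ↔
      SoloInformedKZLocAt (toFormalPeriod (of piRep)) soloInformed_evalP_piRep_ne_zero ∧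
        ∀ d, 3 ≤ d → SoloInformedDiscCancellationRung d := by
  rw [← soloInformed_piCancellation_iff_discCancellation_ge]
  exact soloInformed_kzp_iff_locPi_and_piCancellation

/-- KZP ⇒ disc cancellation at every rung. -/
theorem soloInformed_discCancellationRung_of_kzp (h : KontsevichZagierPeriods) (d : ℕ) :
    SoloInformedDiscCancellationRung d :=
  soloInformed_discCancellationRung_of_piCancellation (soloInformed_piCancellation_of_kzp h) d

end Summit.KontsevichZagierPeriods.KontsevichZagierPeriods.Theorems
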